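import Mathlib.Analysis.SpecialFunctions.Pow.Deriv
import Mathlib.Analysis.SpecialFunctions.Trigonometric.DerivHyp
import Mathlib.Analysis.Complex.RemovableSingularity
import Summits.QuantumFields.BalabanUV.T4Continuum.Spine.NE4.FadingFromRateAnalyticGap
import Summits.QuantumFields.BalabanUV.T4Continuum.Spine.NE4.FadingFromRateRealAnalytic

/-!
# Spine/NE4/FadingFromRateRealAnalyticSharp — the square of the age is ATTAINED: the family `θ^k·cos(ω_k·√g_0)` under the real NE4 +
# analyticity with a uniform complex bound

Cell `pub-balaban-gaps` (YM blitz G2), seat `ne4`, generation 6 (unit `pub-balaban-gaps-ne4-g6`); record `HOME/ne/NE4.md` §5 (R37).  Companion of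
`Spine/NE4/FadingFromRateRealAnalytic` (the two-constants rung: REAL NE4 + `CoordAnalyticC` ⇒ moduli `K₂·θ^{age}·(1 + age·log(1∕θ))²`, fading at
every `θ′ > θ`).  Census question: is the SQUARE of the age in that upper bound an artefact of the fold-map proof, or is it the true price?  The g5
witness `logFamily θ^k·sin(k·log(1∕θ)∕r·g_0)` (`FadingFromRateAnalyticGap`, (R36)) forces only ONE factor `age`.

THE WITNESS.  `sqrtFamily θ r k (g_0,…,g_k) = θ^k·cos(ω_k·√g_0)`, `ω_k = k·log(1∕θ)∕√r`, with the ENTIRE extension `z ↦ θ^k·cos(ω_k·z^{1∕2})`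
(`cosSqrt`; the value does not depend on the root; holomorphic off `0` by the two charts `z^{1∕2}` ∕ `(−z)^{1∕2}` on the slit plane —
`cosSqrt_eq_cosh` — and at `0` by continuity and Mathlib's removable-singularity theorem, `differentiable_cosSqrt`).  On the complex
`r`-neighbourhood of the box, `|Im z^{1∕2}|² = (‖z‖ − Re z)∕2 ≤ r` (`norm_sub_re_le_of_mem_nbhd`), so `‖cos(ω_k z^{1∕2})‖ ≤ e^{ω_k√r} = θ^{−k}`:
the frequency is tuned EXACTLY to the uniform bound `1` (`coordAnalyticC_sqrtFamily`), as `logFamily`'s was — but the growth `e^{ω√|z|}` towards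
the negative axis lets `ω_k` scale like `k∕√r` in the variable `√g_0`, i.e. like `k²∕r` in `g_0` near the box edge `g_0 = 0`.  The real NE4 holds
with `c = 2` (`scaleShiftRate_sqrtFamily`: `|cos| ≤ 1` on the box), and the test couplings `(π∕(2ω_k))²`, `(π∕ω_k)²` (values `0`, `−θ^k`) give
`Λ k 0 ≥ (4∕(3π²))·ω_k²·θ^k = (4log²(1∕θ)∕(3π²r))·k²·θ^k` for EVERY admissible `Λ` and all large `k` (`moduli_lower_sqrtFamily[']`).  Package:
`realAnalytic_rate_sq_exact` — the rung's own moduli are admissible for this family with `Λ₂ k 0 = K₂θ^k(1 + k·log(1∕θ))²`, and nothing admissible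
beats `k²θ^k`: the real-analytic exchange rate is `θ^{age}·age²` EXACTLY in the `HistLipschitz` currency (ONE constant per scale and coupling, a
supremum over the box — dominated by the edge).  In the interior of the box the loss is the single factor `age` (two-sided smallness; `logFamily`),
not formalised as it does not enter the typed shapes.

THE LADDER (all kernel, each rung two-sided): C^{0,1} → none (`fading_needs_regularity`) · C^{1,1} → `√θ` (`sqrt_rate_exact`) · analytic + REAL
NE4 → `θ^{age}·age²` (this file ∧ `histLipschitz_fadingMemory_of_realAnalytic`), hence every `θ′ > θ`, never `θ` · analytic + COMPLEX NE4 → `θ`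
(`analytic_rate_exact`).

HONEST FRAMING: a TOY family of functions exhibiting the sharpness of an elementary estimate about HYPOTHESIS SHAPES; nothing of Bałaban's is
computed or asserted; NE4 is NOT IN PRINT and NOT PROVED; spine PROVED 0∕9 unchanged; NOT the continuum limit on ℝ⁴, NOT infinite volume,
NOT a mass gap, NOT Clay.
-/

noncomputable section

namespace Summit.QuantumFields.BalabanUV.T4Continuum.Spine.NE4

open Set Metric Real
open Literature.MathematicalPhysics.QuantumFieldTheory.Balaban1983to89
open Literature.MathematicalPhysics.QuantumFieldTheory.Balaban1983to89.FlowStep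
open Literature.MathematicalPhysics.QuantumFieldTheory.Balaban1983to89.T4CouplingMatching

/-! ## §1 The entire function `z ↦ cos(ω·√z)` -/

/-- `cosSqrt ω z = cos(ω·z^{1∕2})` with the principal root — the value does not depend on the choice of root (`cos` is even): it is the
entire function `Σ_n (−ω²z)^n∕(2n)!`, of order `1∕2`, bounded by `1` on `[0, ∞)` and growing like `cosh(ω√|z|)` on `(−∞, 0]`. [folklore] -/
def cosSqrt (ω : ℝ) (z : ℂ) : ℂ := Complex.cos ((ω : ℂ) * z ^ (1 / 2 : ℂ))

/-- **THE OTHER CHART**: `cos(ω·z^{1∕2}) = cosh(ω·(−z)^{1∕2})` for EVERY `z` (the two roots of `z` are `±I·(−z)^{1∕2}`, and `cos(±I·w) = cosh w`). [folklore] -/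
theorem cosSqrt_eq_cosh (ω : ℝ) (z : ℂ) : cosSqrt ω z = Complex.cosh ((ω : ℂ) * (-z) ^ (1 / 2 : ℂ)) := by
  unfold cosSqrt
  set u : ℂ := z ^ (1 / 2 : ℂ) with hu
  set v : ℂ := (-z) ^ (1 / 2 : ℂ) with hv
  -- the principal roots square back (`Complex.cpow_nat_inv_pow`; the tree's `…Shintani.cpow_half_sq` states the same — not imported here)
  have hu2 : u ^ 2 = z := by have h := Complex.cpow_nat_inv_pow z two_ne_zero; norm_num at h; exact h
  have hv2 : v ^ 2 = -z := by have h := Complex.cpow_nat_inv_pow (-z) two_ne_zero; norm_num at h; exact h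
  have hsq : ((ω : ℂ) * u) ^ 2 = ((ω : ℂ) * v * Complex.I) ^ 2 := by
    rw [mul_pow, mul_pow, mul_pow, hu2, hv2, Complex.I_sq]; ring
  rcases sq_eq_sq_iff_eq_or_eq_neg.mp hsq with h | h
  · rw [h, Complex.cos_mul_I]
  · rw [h, Complex.cos_neg, Complex.cos_mul_I]

/-- `cosSqrt ω` is ENTIRE: holomorphic off `0` by the two charts (`z` or `−z` in the slit plane), continuous at `0` (the root is), hence
holomorphic at `0` by the removable-singularity theorem. [folklore] -/
theorem differentiable_cosSqrt (ω : ℝ) : Differentiable ℂ (cosSqrt ω) := by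
  have hoff : DifferentiableOn ℂ (cosSqrt ω) (univ \ {0}) := by
    intro z hz
    have hz0 : z ≠ 0 := by simpa using hz
    apply DifferentiableAt.differentiableWithinAt
    rcases Complex.mem_slitPlane_or_neg_mem_slitPlane hz0 with h | h
    · exact ((differentiableAt_id.cpow_const (by exact h)).const_mul (ω : ℂ)).ccos
    · rw [show cosSqrt ω = fun w => Complex.cosh ((ω : ℂ) * (-w) ^ (1 / 2 : ℂ)) from funext (cosSqrt_eq_cosh ω)]
      exact ((differentiableAt_id.neg.cpow_const (by exact h)).const_mul (ω : ℂ)).ccosh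
  have hcont : ContinuousAt (cosSqrt ω) 0 := by
    have h1 : ContinuousAt (fun x : ℂ => x ^ (1 / 2 : ℂ)) 0 :=
      Complex.continuousAt_cpow_const_of_re_pos (Or.inl le_rfl) (by norm_num)
    exact Complex.continuous_cos.continuousAt.comp (continuousAt_const.mul h1)
  have h := (Complex.differentiableOn_compl_singleton_and_continuousAt_iff (f := cosSqrt ω) Filter.univ_mem).mp
    ⟨hoff, hcont⟩
  exact differentiableOn_univ.mp h

/-- The imaginary part of a square root: `u² = z ⟹ (Im u)² = (‖z‖ − Re z)∕2`. [folklore] -/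
theorem im_sq_of_sq_eq {u z : ℂ} (h : u ^ 2 = z) : u.im ^ 2 = (‖z‖ - z.re) / 2 := by
  have hre : z.re = u.re ^ 2 - u.im ^ 2 := by rw [← h, sq, Complex.mul_re]; ring
  have hnorm : ‖z‖ = u.re ^ 2 + u.im ^ 2 := by
    rw [← h, norm_pow, Complex.sq_norm, Complex.normSq_apply]; ring
  rw [hre, hnorm]; ring

/-- On the neighbourhood `Nbhd r γ` of the positive box: `‖z‖ − Re z ≤ 2r` (for `Re z ≥ 0` it is `≤ |Im z| ≤ r`; for `Re z < 0` the point is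
within `r` of `0`, so `‖z‖ ≤ r`). [folklore] -/
theorem norm_sub_re_le_of_mem_nbhd {r γ : ℝ} {z : ℂ} (hz : z ∈ Nbhd r γ) : ‖z‖ - z.re ≤ 2 * r := by
  have him : |z.im| ≤ r := abs_im_le_of_mem_nbhd hz
  have hr : 0 ≤ r := (abs_nonneg _).trans him
  rcases le_or_gt 0 z.re with h0 | h0
  · have := Complex.norm_le_abs_re_add_abs_im z
    rw [abs_of_nonneg h0] at this
    linarith
  · obtain ⟨t, ht, hzt⟩ := hz
    have hzn : ‖z‖ ≤ r := by
      have h1 : ‖z‖ ^ 2 ≤ ‖z - (t : ℂ)‖ ^ 2 := by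
        rw [Complex.sq_norm, Complex.sq_norm, Complex.normSq_apply, Complex.normSq_apply]
        simp only [Complex.sub_re, Complex.ofReal_re, Complex.sub_im, Complex.ofReal_im, sub_zero]
        nlinarith [ht.1]
      have h2 : ‖z‖ ≤ ‖z - (t : ℂ)‖ := (pow_le_pow_iff_left₀ (norm_nonneg _) (norm_nonneg _) two_ne_zero).mp h1
      exact h2.trans hzt
    have h3 : -‖z‖ ≤ z.re := (abs_le.mp (Complex.abs_re_le_norm z)).1
    linarith


/-- **THE GROWTH BOUND ON THE NEIGHBOURHOOD**: for `z ∈ Nbhd r γ`, `‖cosSqrt ω z‖ ≤ exp(|ω|·√r)` (`‖cos w‖ ≤ e^{|Im w|}`, the tree's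
`Literature.NumberTheory.LFunctions.norm_cos_le_exp_abs_im`, and `|Im z^{1∕2}| = √((‖z‖ − Re z)∕2) ≤ √r`). [folklore] -/
theorem norm_cosSqrt_le {ω r γ : ℝ} {z : ℂ} (hz : z ∈ Nbhd r γ) : ‖cosSqrt ω z‖ ≤ Real.exp (|ω| * √r) := by
  set u : ℂ := z ^ (1 / 2 : ℂ) with hu
  have him2 : u.im ^ 2 ≤ r := by
    rw [im_sq_of_sq_eq (show u ^ 2 = z by have h := Complex.cpow_nat_inv_pow z two_ne_zero; norm_num at h; exact h)]
    have := norm_sub_re_le_of_mem_nbhd hz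
    linarith
  have him : |u.im| ≤ √r := Real.abs_le_sqrt him2
  have h1 := Literature.NumberTheory.LFunctions.norm_cos_le_exp_abs_im ((ω : ℂ) * u)
  rw [Complex.im_ofReal_mul, abs_mul] at h1
  exact h1.trans (Real.exp_le_exp.mpr (mul_le_mul_of_nonneg_left him (abs_nonneg ω)))

/-- The real restriction: `cosSqrtR ω t = cos(ω√t)` for `t ≥ 0` and `cosh(ω√(−t))` for `t < 0`. [folklore] -/
def cosSqrtR (ω t : ℝ) : ℝ := if 0 ≤ t then Real.cos (ω * √t) else Real.cosh (ω * √(-t))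

/-- `cosSqrt ω` is REAL on the real axis, with value `cosSqrtR ω t`. [folklore] -/
theorem cosSqrt_ofReal (ω t : ℝ) : cosSqrt ω (t : ℂ) = (cosSqrtR ω t : ℂ) := by
  unfold cosSqrtR
  split_ifs with ht
  · unfold cosSqrt
    rw [show ((t : ℂ) ^ (1 / 2 : ℂ)) = ((√t : ℝ) : ℂ) by
      rw [Real.sqrt_eq_rpow, Complex.ofReal_cpow ht]; norm_num,
      ← Complex.ofReal_mul, ← Complex.ofReal_cos]
  · rw [cosSqrt_eq_cosh, show (-(t : ℂ)) ^ (1 / 2 : ℂ) = ((√(-t) : ℝ) : ℂ) by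
      rw [← Complex.ofReal_neg, Real.sqrt_eq_rpow, Complex.ofReal_cpow (by linarith)]; norm_num,
      ← Complex.ofReal_mul, ← Complex.ofReal_cosh]

/-- `|cosSqrtR ω t| ≤ 1` for `t ≥ 0`. [folklore] -/
theorem abs_cosSqrtR_le_one {ω t : ℝ} (ht : 0 ≤ t) : |cosSqrtR ω t| ≤ 1 := by
  unfold cosSqrtR; rw [if_pos ht]; exact Real.abs_cos_le_one _

/-! ## §2 The witness family `θ^k·cos(ω_k·√g_0)`, `ω_k = k·log(1∕θ)∕√r`: real NE4 and analyticity with bound `1` -/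

/-- The frequency `ω_k = k·log(1∕θ)∕√r` (= `logFreq θ √r k`). [folklore] -/
def sqrtFreq (θ r : ℝ) (k : ℕ) : ℝ := logFreq θ (√r) k

/-- THE WITNESS over ℂ: `sqrtFamilyC θ r k (w_0,…,w_k) = θ^k·cos(ω_k·√w_0)` (entire in `w_0`, constant in the others). [folklore] -/
def sqrtFamilyC (θ r : ℝ) : HBetaC := fun k w => (θ : ℂ) ^ k * cosSqrt (sqrtFreq θ r k) (w 0)

/-- Its real restriction. [folklore] -/
def sqrtFamily (θ r : ℝ) : HBeta := fun k v => θ ^ k * cosSqrtR (sqrtFreq θ r k) (v 0)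

/-- `sqrtFamilyC` extends `sqrtFamily`. [folklore] -/
theorem extendsC_sqrtFamily (θ r : ℝ) : ExtendsC (sqrtFamily θ r) (sqrtFamilyC θ r) := by
  intro k v
  simp only [sqrtFamily, sqrtFamilyC, cosSqrt_ofReal, Complex.ofReal_mul, Complex.ofReal_pow]

/-- On the box (indeed whenever `g_0 ≥ 0`): `|sqrtFamily θ r k v| ≤ θ^k` (`θ ≥ 0`). [folklore] -/
theorem abs_sqrtFamily_le_pow {θ r : ℝ} (hθ0 : 0 ≤ θ) (k : ℕ) {v : Fin (k + 1) → ℝ} (hv : 0 ≤ v 0) :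
    |sqrtFamily θ r k v| ≤ θ ^ k := by
  unfold sqrtFamily
  rw [abs_mul, abs_of_nonneg (pow_nonneg hθ0 k)]
  exact mul_le_of_le_one_right (pow_nonneg hθ0 k) (abs_cosSqrtR_le_one hv)

/-- **THE REAL NE4 AT RATE `θ`**: `ScaleShiftRate 2 θ γ (sqrtFamily θ r)` (`0 ≤ θ ≤ 1`). [folklore] -/
theorem scaleShiftRate_sqrtFamily {θ r γ : ℝ} (hθ0 : 0 ≤ θ) (hθ1 : θ ≤ 1) : ScaleShiftRate 2 θ γ (sqrtFamily θ r) := by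
  intro k w hw
  have hw0 : 0 ≤ w 0 := ((mem_box.mp hw) 0).1.le
  have h1 := abs_sqrtFamily_le_pow (r := r) hθ0 (k + 1) hw0
  have h2 := abs_sqrtFamily_le_pow (r := r) hθ0 k (v := Fin.tail w) (by simpa [Fin.tail] using ((mem_box.mp hw) 1).1.le)
  have hθk : θ ^ (k + 1) ≤ θ ^ k := pow_le_pow_of_le_one hθ0 hθ1 (Nat.le_succ k)
  calc |sqrtFamily θ r (k + 1) w - sqrtFamily θ r k (Fin.tail w)|
      ≤ |sqrtFamily θ r (k + 1) w| + |sqrtFamily θ r k (Fin.tail w)| := abs_sub _ _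
    _ ≤ θ ^ (k + 1) + θ ^ k := add_le_add h1 h2
    _ ≤ 2 * θ ^ k := by linarith

/-- **ANALYTIC WITH UNIFORM BOUND `1` ON THE NEIGHBOURHOOD**: `CoordAnalyticC 1 γ r (sqrtFamilyC θ r)` (`0 < θ ≤ 1`, `r > 0`): the section in
`g_0` is ENTIRE with `‖θ^k·cos(ω_k√z)‖ ≤ θ^k·e^{ω_k√r} = 1` on `Nbhd r γ` — the frequency is tuned to the bound; the other sections are constant
with modulus `≤ θ^k ≤ 1`. [folklore] -/
theorem coordAnalyticC_sqrtFamily {θ r γ : ℝ} (hθ0 : 0 < θ) (hθ1 : θ ≤ 1) (hr : 0 < r) : CoordAnalyticC 1 γ r (sqrtFamilyC θ r) := by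
  intro k p hp i
  have hω : 0 ≤ sqrtFreq θ r k := logFreq_nonneg hθ0 hθ1 (Real.sqrt_pos.mpr hr) k
  have hval : ∀ u ∈ Nbhd r γ, ‖(θ : ℂ) ^ k * cosSqrt (sqrtFreq θ r k) u‖ ≤ 1 := by
    intro u hu
    rw [norm_mul, norm_pow, Complex.norm_real, Real.norm_eq_abs, abs_of_pos hθ0]
    calc θ ^ k * ‖cosSqrt (sqrtFreq θ r k) u‖ ≤ θ ^ k * Real.exp (|sqrtFreq θ r k| * √r) :=
          mul_le_mul_of_nonneg_left (norm_cosSqrt_le hu) (pow_nonneg hθ0.le k)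
      _ = 1 := by rw [abs_of_nonneg hω]; exact pow_mul_exp_logFreq hθ0 (Real.sqrt_pos.mpr hr).ne' k
  refine ⟨univ, isOpen_univ, subset_univ _, ?_, ?_⟩
  · refine Differentiable.differentiableOn ?_
    by_cases hi : i = 0
    · subst hi
      simp only [sqrtFamilyC, Function.update_self]
      exact (differentiable_const _).mul (differentiable_cosSqrt _)
    · simp only [sqrtFamilyC, Function.update_of_ne (Ne.symm hi)]
      exact differentiable_const _
  · intro z hz
    by_cases hi : i = 0
    · subst hi
      simp only [sqrtFamilyC, Function.update_self]
      exact hval z hz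
    · simp only [sqrtFamilyC, Function.update_of_ne (Ne.symm hi)]
      exact hval _ (ofReal_mem_nbhd hr.le ((mem_box.mp hp) 0))

/-! ## §3 The admissible moduli carry the SQUARE of the age -/

/-- **EVERY ADMISSIBLE MODULUS IS `≥ (4∕(3π²))·ω_k²·θ^k` IN THE OLDEST COUPLING** once `π ≤ ω_k·√γ` (so that the test couplings
`(π∕(2ω_k))² < (π∕ω_k)² ≤ γ` lie in the box): values `θ^k·cos(π∕2) = 0` and `θ^k·cos π = −θ^k` at distance `(3∕4)(π∕ω_k)²` — the
difference quotient near the box edge `g_0 = 0` is of order `ω_k² = k²·log²(1∕θ)∕r`. [folklore] -/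
theorem moduli_lower_sqrtFamily {θ r γ : ℝ} (hθ0 : 0 < θ) {Λ : ℕ → ℕ → ℝ} (hL : HistLipschitz Λ γ (sqrtFamily θ r)) {k : ℕ}
    (hω : 0 < sqrtFreq θ r k) (hk : π ≤ sqrtFreq θ r k * √γ) : 4 / (3 * π ^ 2) * sqrtFreq θ r k ^ 2 * θ ^ k ≤ Λ k 0 := by
  set ω : ℝ := sqrtFreq θ r k with hωdef
  have hθk : 0 < θ ^ k := pow_pos hθ0 k
  have hγ0 : 0 ≤ γ := by
    by_contra h
    have : √γ = 0 := Real.sqrt_eq_zero'.mpr (le_of_lt (not_le.mp h))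
    rw [this, mul_zero] at hk; linarith [Real.pi_pos]
  have hγ : (π / ω) ^ 2 ≤ γ := by
    have h1 : π / ω ≤ √γ := by rw [div_le_iff₀ hω]; linarith [mul_comm ω (√γ)]
    calc (π / ω) ^ 2 ≤ (√γ) ^ 2 := pow_le_pow_left₀ (by positivity) h1 2
      _ = γ := Real.sq_sqrt hγ0
  set a : ℝ := (π / (2 * ω)) ^ 2 with ha
  set b : ℝ := (π / ω) ^ 2 with hb
  have ha0 : 0 < a := by positivity
  have hab : a ≤ b := by
    rw [ha, hb]; apply pow_le_pow_left₀ (by positivity)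
    rw [div_le_div_iff_of_pos_left (by positivity) (by positivity) hω]; linarith
  set p : Fin (k + 1) → ℝ := Function.update (fun _ => γ) 0 a with hp
  set q : Fin (k + 1) → ℝ := Function.update (fun _ => γ) 0 b with hq
  have hγpos : 0 < γ := lt_of_lt_of_le (by positivity) hγ
  have hbox : ∀ x : ℝ, 0 < x → x ≤ γ → Function.update (fun _ : Fin (k + 1) => γ) 0 x ∈ Box γ k := fun x hx0 hxγ => by
    rw [mem_box]; intro j
    by_cases hj : j = 0
    · subst hj; simpa using ⟨hx0, hxγ⟩
    · rw [Function.update_of_ne hj]; exact ⟨hγpos, le_rfl⟩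
  have hpb : p ∈ Box γ k := hbox _ ha0 (hab.trans hγ)
  have hqb : q ∈ Box γ k := hbox _ (by positivity) hγ
  have h := hL k p q hpb hqb
  have hsa : √a = π / (2 * ω) := by rw [ha]; exact Real.sqrt_sq (by positivity)
  have hsb : √b = π / ω := by rw [hb]; exact Real.sqrt_sq (by positivity)
  have hωa : ω * √a = π / 2 := by rw [hsa]; field_simp
  have hωb : ω * √b = π := by rw [hsb]; field_simp
  have hval : |sqrtFamily θ r k p - sqrtFamily θ r k q| = θ ^ k := by
    simp only [sqrtFamily, cosSqrtR, ← hωdef, hp, hq, Function.update_self, if_pos ha0.le,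
      if_pos (show (0:ℝ) ≤ b by positivity), hωa, hωb, Real.cos_pi_div_two, Real.cos_pi, mul_zero, mul_neg, mul_one,
      zero_sub, abs_neg]
    exact abs_of_nonneg hθk.le
  have hsum : ∑ i : Fin (k + 1), Λ k i * |p i - q i| = Λ k 0 * (b - a) := by
    rw [Finset.sum_eq_single (0 : Fin (k + 1))]
    · simp only [hp, hq, Function.update_self, Fin.val_zero]
      rw [abs_sub_comm, abs_of_nonneg (by linarith)]
    · intro j _ hj
      simp [hp, hq, Function.update_of_ne hj]
    · simp
  rw [hval, hsum] at h
  have hba : b - a = 3 / 4 * (π / ω) ^ 2 := by rw [ha, hb]; ring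
  rw [hba] at h
  -- `θ^k ≤ Λ k 0 · (3/4)(π/ω)²` ⇒ `(4/(3π²)) ω² θ^k ≤ Λ k 0`
  have hc : 0 < 4 / (3 * π ^ 2) * ω ^ 2 := by positivity
  calc 4 / (3 * π ^ 2) * ω ^ 2 * θ ^ k ≤ 4 / (3 * π ^ 2) * ω ^ 2 * (Λ k 0 * (3 / 4 * (π / ω) ^ 2)) :=
        mul_le_mul_of_nonneg_left h hc.le
    _ = Λ k 0 := by field_simp

/-- The same in the form `Λ k 0 ≥ (4·log²(1∕θ)∕(3π²·r))·k²·θ^k` (`ω_k² = k²log²(1∕θ)∕r`). [folklore] -/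
theorem moduli_lower_sqrtFamily' {θ r γ : ℝ} (hθ0 : 0 < θ) (hr : 0 < r) {Λ : ℕ → ℕ → ℝ}
    (hL : HistLipschitz Λ γ (sqrtFamily θ r)) {k : ℕ} (hω : 0 < sqrtFreq θ r k) (hk : π ≤ sqrtFreq θ r k * √γ) :
    4 * Real.log (1 / θ) ^ 2 / (3 * π ^ 2 * r) * (k : ℝ) ^ 2 * θ ^ k ≤ Λ k 0 := by
  have h := moduli_lower_sqrtFamily hθ0 hL hω hk
  have e : sqrtFreq θ r k ^ 2 = (k : ℝ) ^ 2 * Real.log (1 / θ) ^ 2 / r := by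
    unfold sqrtFreq logFreq
    rw [div_pow, mul_pow, Real.sq_sqrt hr.le]
  rw [e] at h
  calc 4 * Real.log (1 / θ) ^ 2 / (3 * π ^ 2 * r) * (k : ℝ) ^ 2 * θ ^ k
      = 4 / (3 * π ^ 2) * ((k : ℝ) ^ 2 * Real.log (1 / θ) ^ 2 / r) * θ ^ k := by field_simp
    _ ≤ Λ k 0 := h


/-! ## §4 The real-analytic rung is `θ^{age}·age²`, exactly -/

/-- For all large `k` the test couplings fit in the box and the frequency is positive: `π ≤ ω_k·√γ` and `0 < ω_k` for `k ≥ k₀`. [folklore] -/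
theorem sqrtFreq_eventually {θ r γ : ℝ} (hθ0 : 0 < θ) (hθ1 : θ < 1) (hr : 0 < r) (hγ : 0 < γ) :
    ∃ k₀ : ℕ, ∀ k, k₀ ≤ k → 0 < sqrtFreq θ r k ∧ π ≤ sqrtFreq θ r k * √γ := by
  have hℓ : 0 < Real.log (1 / θ) := Real.log_pos (by rw [lt_div_iff₀ hθ0]; linarith)
  have hsr : 0 < √r := Real.sqrt_pos.mpr hr
  have hsγ : 0 < √γ := Real.sqrt_pos.mpr hγ
  obtain ⟨k₀, hk₀⟩ := exists_nat_ge (π * √r / (Real.log (1 / θ) * √γ) + 1)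
  refine ⟨k₀, fun k hk => ?_⟩
  have hk' : π * √r / (Real.log (1 / θ) * √γ) + 1 ≤ (k : ℝ) := hk₀.trans (by exact_mod_cast hk)
  have hkpos : (0 : ℝ) < k := lt_of_lt_of_le (by positivity) hk'
  have hω : sqrtFreq θ r k = (k : ℝ) * Real.log (1 / θ) / √r := rfl
  refine ⟨by rw [hω]; positivity, ?_⟩
  rw [hω]
  have h1 : π * √r / (Real.log (1 / θ) * √γ) ≤ (k : ℝ) := by linarith
  rw [div_le_iff₀ (by positivity)] at h1
  rw [div_mul_eq_mul_div, le_div_iff₀ hsr]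
  linarith

/-- **THE REAL-ANALYTIC RUNG IS `θ^{age}·(age)²`, EXACTLY (up to constants).**  The family `sqrtFamily θ r` meets every hypothesis of
`histLipschitz_fadingMemory_of_realAnalytic` (`ExtendsC`, the real NE4 with `c = 2`, `CoordAnalyticC` with `B = 1`), so the derived moduli
`Λ₂ = realAnalyticModuli 2 θ 1 r γ` ARE admissible, with `Λ₂ k 0 = K₂·θ^k·(1 + k·log(1∕θ))²`; and EVERY admissible `Λ` has
`Λ k 0 ≥ (4log²(1∕θ)∕(3π²r))·k²·θ^k` for all large `k` (`moduli_lower_sqrtFamily'`).  So in the `HistLipschitz` currency the price of trading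
(R34)'s complex NE4 for the real one is EXACTLY the square of the age (the edge effect of the one-sided smallness), not the single factor `age`
of the interior witness `logFamily` (R36). [folklore] -/
theorem realAnalytic_rate_sq_exact {θ r γ : ℝ} (hθ0 : 0 < θ) (hθ1 : θ < 1) (hr : 0 < r) (hγ : 0 < γ) :
    (HistLipschitz (realAnalyticModuli 2 θ 1 r γ) γ (sqrtFamily θ r) ∧
      ∀ k, realAnalyticModuli 2 θ 1 r γ k 0 = realAnalyticConst 2 θ 1 r γ * θ ^ k * (1 + (k : ℝ) * (-Real.log θ)) ^ 2) ∧
    ∀ Λ : ℕ → ℕ → ℝ, HistLipschitz Λ γ (sqrtFamily θ r) →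
      ∃ k₀ : ℕ, ∀ k, k₀ ≤ k → 4 * Real.log (1 / θ) ^ 2 / (3 * π ^ 2 * r) * (k : ℝ) ^ 2 * θ ^ k ≤ Λ k 0 := by
  refine ⟨⟨(histLipschitz_fadingMemory_of_realAnalytic (extendsC_sqrtFamily θ r) (scaleShiftRate_sqrtFamily hθ0.le hθ1.le)
      (by norm_num) hθ0 hθ1 (coordAnalyticC_sqrtFamily hθ0 hθ1.le hr) one_pos hr hγ).1, fun k => ?_⟩, fun Λ hL => ?_⟩
  · simp [realAnalyticModuli]
  · obtain ⟨k₀, hk₀⟩ := sqrtFreq_eventually hθ0 hθ1 hr hγ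
    exact ⟨k₀, fun k hk => moduli_lower_sqrtFamily' hθ0 hr hL (hk₀ k hk).1 (hk₀ k hk).2⟩

end Summit.QuantumFields.BalabanUV.T4Continuum.Spine.NE4

end
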